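import Literature.Analysis.FluidPDE.DriftHeatInteriorLipschitz
import Literature.Analysis.FluidPDE.SpaceTimeCalculus
import HarnessLib

/-!
# Crux `LinearLiouvilleSeven` (stmt-NavierStokesRegularity-4054), line `galilean-collapse`: STUB A2

Slice-Lipschitz (oscillation) estimate for linearly growing ancient caloric functions on
`(−∞, 0) × ℝ³` — the registered stub `stub_caloricSliceLipschitz` of the line's skeleton
(`Cruxes/LinearLiouvilleSeven/Lines/galilean-collapse.lean`). Helper file for the crux item
(lands `--supports stmt-NavierStokesRegularity-4054`).

## Proof

A jointly smooth classical solution `W` of the heat equation on `(−∞, 0) × ℝ³` is a member of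
the tree's local time-integrated drift–heat class `IsDriftHeatSolutionOn` with zero drift
(`C²` slices; `D(W t)` and `Δ(W t)` jointly continuous by `IsSmoothSpaceTimeOn.fderiv_slice` /
`IsSmoothSpaceTimeOn.laplacian`; `W t x − W s x = ∫ₛᵗ Δ(W r) x dr` by the fundamental theorem of
calculus). The tree's Ishii–Lions interior Lipschitz estimate
`IsDriftHeatSolutionOn.abs_sub_le_lipConst` on the parabolic cylinder
`[t₀ − ρ², t₀] × B̄(x, 2ρ)` with the bound `|W| ≤ M := A + B(‖x‖ + 2ρ) + 1` gives, since
`lipRad 0 ρ = ρ` and `lipConst 0 ρ 3 = 11/ρ`,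
`|W(t₀, y) − W(t₀, x)| ≤ 11 (A + 1 + B‖x‖) ‖y − x‖ / ρ + 22 B ‖y − x‖` for every
`ρ ≥ max 1 ‖y − x‖`; letting `ρ → ∞` yields the claim. With `B = 0` this is the parabolic
Liouville theorem "bounded ancient caloric functions are slice-constant".
-/

noncomputable section

open Set Function Metric MeasureTheory
open scoped Laplacian ContDiff Topology
open Literature.Analysis.FluidPDE

namespace Summit.NavierStokesRegularity.NavierStokesRegularity.Theorems

/-- A classical solution of the heat equation, jointly smooth on `(−∞, 0) × ℝ³`, belongs to the
tree's time-integrated drift–heat class with zero drift on the time set `(−∞, 0)` and all of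
space: its slices are `C²`, `D(W t)(x)` and `Δ(W t)(x)` are jointly continuous, and
`W t x − W s x = ∫ₛᵗ Δ(W r)(x) dr` by the fundamental theorem of calculus. -/
theorem isDriftHeatSolutionOn_of_caloric {W : ℝ → EuclideanSpace ℝ (Fin 3) → ℝ}
    (hW : IsSmoothSpaceTimeOn (Iio 0) W)
    (hheat : ∀ t < 0, ∀ x, timeDeriv W t x = (Δ (W t)) x) :
    IsDriftHeatSolutionOn (fun _ _ => (0 : EuclideanSpace ℝ (Fin 3))) W 0 (Iio 0) univ where
  measurable_drift := measurable_const
  norm_drift_le t _ x _ := by simp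
  contDiffOn t ht := (contDiff_infty.1 (hW.contDiff_slice ht) 2).contDiffOn
  continuousOn_fderiv := hW.continuousOn_fderiv_slice isOpen_Iio.uniqueDiffOn
  continuousOn_laplacian := (hW.laplacian isOpen_Iio.uniqueDiffOn).continuousOn
  integral_eq x _ s hs t ht hst := by
    have hsub : uIcc s t ⊆ Iio 0 := ordConnected_Iio.uIcc_subset hs ht
    have hderiv : ∀ r ∈ uIcc s t, HasDerivAt (fun r' => W r' x) ((Δ (W r)) x) r := by
      intro r hr
      have hr0 : r < 0 := hsub hr
      have h1 := hW.hasDerivAt_timeLine isOpen_Iio hr0 x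
      refine h1.congr_deriv ?_
      rw [← timeDeriv_apply, hheat r hr0 x]
    have hcont : ContinuousOn (fun r => (Δ (W r)) x) (uIcc s t) :=
      continuousOn_time_slice (F := fun p : ℝ × EuclideanSpace ℝ (Fin 3) => (Δ (W p.1)) p.2)
        (hW.laplacian isOpen_Iio.uniqueDiffOn).continuousOn (mem_univ x) hsub
    simp only [map_zero, sub_zero]
    exact (intervalIntegral.integral_eq_sub_of_hasDerivAt hderiv hcont.intervalIntegrable).symm

/-- The Lipschitz constant of the tree's interior estimate for zero drift in dimension three:
`lipConst 0 ρ 3 = 4/ρ + 2 · (7/2)/ρ² · ρ = 11/ρ`. -/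
theorem lipConst_zero_three {ρ : ℝ} (hρ : 0 < ρ) : lipConst 0 ρ 3 = 11 / ρ := by
  unfold lipConst lipRad lipAux
  have hρ0 : ρ ≠ 0 := hρ.ne'
  field_simp
  ring

/-- **Slice-Lipschitz (oscillation) estimate for linearly growing ancient caloric functions** —
registered stub A2 of crux stmt-NavierStokesRegularity-4054, line `galilean-collapse`. If
`W : ℝ → ℝ³ → ℝ` is jointly `C^∞` on `(−∞, 0) × ℝ³`, solves the heat equation classically there
(`∂ₜW = ΔW`, two-sided `timeDeriv`), and `|W(t, x)| ≤ A + B‖x‖` for all `t ≤ t₀ < 0`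
(`A, B ≥ 0`), then the slice `W(t₀, ·)` is `22B`-Lipschitz:
`|W(t₀, y) − W(t₀, x)| ≤ 22 B ‖y − x‖`. Proof: the Ishii–Lions interior Lipschitz estimate
`IsDriftHeatSolutionOn.abs_sub_le_lipConst` (zero drift) on the parabolic cylinders
`[t₀ − ρ², t₀] × B̄(x, 2ρ)`, `ρ → ∞`. With `B = 0` it is the parabolic Liouville theorem "bounded
ancient caloric functions are slice-constant". [cite: Lieberman1996, Ch. II] -/
theorem stub_caloricSliceLipschitz :
    ∀ (W : ℝ → EuclideanSpace ℝ (Fin 3) → ℝ) (t₀ A B : ℝ), t₀ < 0 → ContDiffOn ℝ (⊤ : ℕ∞)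
    (Function.uncurry W) (Set.Iio 0 ×ˢ Set.univ) → (∀ t < 0, ∀ x,
    Literature.Analysis.FluidPDE.timeDeriv W t x = Laplacian.laplacian (W t) x) → 0 ≤ A → 0 ≤ B →
    (∀ t ≤ t₀, ∀ x, |W t x| ≤ A + B * ‖x‖) → ∀ x y, |W t₀ y - W t₀ x| ≤ 22 * B * ‖y - x‖ := by
  intro W t₀ A B ht₀ hWs hheat hA hB hbd x y
  have hW : IsSmoothSpaceTimeOn (Iio 0) W := hWs
  have hcl := isDriftHeatSolutionOn_of_caloric hW hheat
  set d : ℝ := ‖y - x‖ with hd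
  have hd0 : 0 ≤ d := norm_nonneg _
  -- the constant in front of `1/ρ`
  set C : ℝ := 11 * (A + 1 + B * ‖x‖) * d with hC
  have hC0 : 0 ≤ C := by positivity
  refine le_of_forall_pos_le_add fun ε hε => ?_
  -- choose a large radius
  set ρ : ℝ := max 1 (max d (C / ε)) with hρdef
  have hρ1 : 1 ≤ ρ := le_max_left _ _
  have hρ : 0 < ρ := lt_of_lt_of_le one_pos hρ1
  have hdρ : d ≤ ρ := (le_max_left _ _).trans (le_max_right _ _)
  have hCρ : C / ε ≤ ρ := (le_max_right _ _).trans (le_max_right _ _)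
  have hCε : C / ρ ≤ ε := by
    rw [div_le_iff₀ hρ]
    calc C = ε * (C / ε) := by field_simp
      _ ≤ ε * ρ := mul_le_mul_of_nonneg_left hCρ hε.le
  -- the bound on the cylinder
  set M : ℝ := A + B * (‖x‖ + 2 * ρ) + 1 with hM
  have hMpos : 0 < M := by positivity
  have hS : Icc (t₀ - ρ ^ 2) t₀ ⊆ Iio 0 := fun t ht => lt_of_le_of_lt ht.2 ht₀
  have hbdM : ∀ t ∈ Icc (t₀ - ρ ^ 2) t₀, ∀ z ∈ closedBall x (2 * ρ), |W t z| ≤ M := by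
    intro t ht z hz
    rw [mem_closedBall, dist_eq_norm] at hz
    have hz' : ‖z‖ ≤ ‖x‖ + 2 * ρ := by
      calc ‖z‖ = ‖(z - x) + x‖ := by rw [sub_add_cancel]
        _ ≤ ‖z - x‖ + ‖x‖ := norm_add_le _ _
        _ ≤ 2 * ρ + ‖x‖ := by linarith
        _ = ‖x‖ + 2 * ρ := by ring
    calc |W t z| ≤ A + B * ‖z‖ := hbd t ht.2 z
      _ ≤ A + B * (‖x‖ + 2 * ρ) := by gcongr
      _ ≤ M := by rw [hM]; linarith
  have hy : y ∈ closedBall x (lipRad 0 ρ) := by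
    rw [mem_closedBall, dist_eq_norm]
    have : lipRad 0 ρ = ρ := by simp [lipRad]
    rw [this]
    exact hdρ
  have key := hcl.abs_sub_le_lipConst isOpen_univ hρ hMpos (subset_univ _) hS hbdM y hy
  rw [finrank_euclideanSpace_fin, Nat.cast_ofNat, lipConst_zero_three hρ] at key
  calc |W t₀ y - W t₀ x| ≤ 11 / ρ * M * ‖y - x‖ := key
    _ = C / ρ + 22 * B * d := by
      rw [hC, hM, hd]
      field_simp
      ring
    _ ≤ ε + 22 * B * d := by linarith
    _ = 22 * B * ‖y - x‖ + ε := by rw [hd]; ring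

end Summit.NavierStokesRegularity.NavierStokesRegularity.Theorems

end
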